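import Literature.NumberTheory.Transcendental.PhilipponZeroEstimateHilbert
import HarnessLib

/-!
# Philippon's zero estimate on `𝔾ₐ × 𝔾ₘ^n`: components of an ideal at a prime, thick additivity

Topic `Literature/NumberTheory/Transcendental`. Eighth module of the inline discharge of
`Literature.NumberTheory.Transcendental.Philippon1986_GaGm`. Roy's proof of Thm. 4.1 (LNM 1752,
Ch. 11) compares the Hilbert function of the special ideal `𝔄` with those of its primary
components `𝔮(𝒱)` at the top-dimensional components `𝒱` (Prop. 3.8 (95)–(97), §2.2 (ii)). We
avoid primary decomposition: for a prime `𝔭` and an ideal `I`, the **component of `I` at `𝔭`** is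
the elementary ideal `GaGm.loc 𝔭 h𝔭 I = I·B_𝔭 ∩ B = {f ; ∃ P ∉ 𝔭, P f ∈ I}` (Roy's
`𝔮(𝒱) = I·𝒪(G)_𝔭 ∩ 𝒪(G)`, Prop. 3.8 Step 1), and everything needed about it is PROVED directly:

* `le_loc`, `loc_mono`, `loc_loc`, `loc_le` (`I ≤ 𝔭 ⇒ loc 𝔭 I ≤ 𝔭`), `isNZDMod_loc`
  (elements outside `𝔭` are non-zero-divisors modulo `loc 𝔭 I`), `isNZDMod_finsetInf`,
  `pow_mem_loc`;
* **`exists_sum_hilbI_loc_le`** — thick additivity: for a finite family of pairwise incomparable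
  primes `𝔭ᵢ ⊇ I` with `𝔭ᵢ^M ≤ loc 𝔭ᵢ I` (i.e. `𝔭ᵢ` minimal over `I`), there is a shift `δ` with
  `∑ᵢ H_{loc 𝔭ᵢ I}(t - δ) ≤ H_{⋂ᵢ loc 𝔭ᵢ I}(t)` for `t ≥ δ` — §2.2 (ii) "`deg I = ∑ deg 𝔮ᵢ`" in
  the inequality form the zero estimate uses, for the box filtration (`GaGm.hilbI` of
  `GaGmBezout.lean`; non-zero-divisor additivity from `…Hilbert.lean`).

## References

* Yu. V. Nesterenko, P. Philippon (eds.), *Introduction to Algebraic Independence Theory*,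
  LNM 1752, Springer 2001, Ch. 11 (D. Roy), §2.2 (ii), §2.3 (86), Prop. 3.8 Step 1.
* P. Philippon, *Lemmes de zéros dans les groupes algébriques commutatifs*, Bull. Soc. Math.
  France 114 (1986), 355–383, §3.
-/

noncomputable section

open MvPolynomial Module

namespace Literature.NumberTheory.Transcendental

namespace GaGm

variable {n : ℕ} {D₀ D₁ : ℕ}

/-- **The component of `I` at the prime `𝔭`**: `loc 𝔭 h𝔭 I = I·B_𝔭 ∩ B = {f ; ∃ P ∉ 𝔭, P·f ∈ I}`.
[cite: NesterenkoPhilippon2001, Ch. 11 §2.3 (86)] -/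
def loc (𝔭 : Ideal (MvPolynomial (Fin (n + 1)) ℂ)) (h𝔭 : 𝔭.IsPrime) (I : Ideal (MvPolynomial (Fin (n + 1)) ℂ)) :
    Ideal (MvPolynomial (Fin (n + 1)) ℂ) where
  carrier := {f | ∃ P ∉ 𝔭, P * f ∈ I}
  zero_mem' := ⟨1, fun h => h𝔭.ne_top ((Ideal.eq_top_iff_one _).mpr h), by simp⟩
  add_mem' := by
    rintro f g ⟨P, hP, hPf⟩ ⟨Q, hQ, hQg⟩
    refine ⟨P * Q, fun h => (h𝔭.mem_or_mem h).elim hP hQ, ?_⟩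
    rw [mul_add]
    refine I.add_mem ?_ ?_
    · rw [mul_comm P Q, mul_assoc]; exact I.mul_mem_left Q hPf
    · rw [mul_assoc]; exact I.mul_mem_left P hQg
  smul_mem' := by
    rintro c f ⟨P, hP, hPf⟩
    refine ⟨P, hP, ?_⟩
    rw [smul_eq_mul, mul_left_comm]
    exact I.mul_mem_left c hPf

section Loc

variable {𝔭 : Ideal (MvPolynomial (Fin (n + 1)) ℂ)} (h𝔭 : 𝔭.IsPrime) {I J : Ideal (MvPolynomial (Fin (n + 1)) ℂ)}

/-- Membership in the component. [folklore] -/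
theorem mem_loc_iff {f : MvPolynomial (Fin (n + 1)) ℂ} : f ∈ loc 𝔭 h𝔭 I ↔ ∃ P ∉ 𝔭, P * f ∈ I := Iff.rfl

/-- `I ≤ loc 𝔭 I`. [folklore] -/
theorem le_loc (I : Ideal (MvPolynomial (Fin (n + 1)) ℂ)) : I ≤ loc 𝔭 h𝔭 I := fun f hf =>
  ⟨1, fun h => h𝔭.ne_top ((Ideal.eq_top_iff_one _).mpr h), by simpa using hf⟩

/-- `loc 𝔭` is monotone. [folklore] -/
theorem loc_mono (h : I ≤ J) : loc 𝔭 h𝔭 I ≤ loc 𝔭 h𝔭 J := fun _ ⟨P, hP, hPf⟩ => ⟨P, hP, h hPf⟩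

/-- `loc 𝔭` is idempotent. [folklore] -/
theorem loc_loc (I : Ideal (MvPolynomial (Fin (n + 1)) ℂ)) : loc 𝔭 h𝔭 (loc 𝔭 h𝔭 I) = loc 𝔭 h𝔭 I := by
  refine le_antisymm ?_ (le_loc h𝔭 _)
  rintro f ⟨P, hP, Q, hQ, hQPf⟩
  refine ⟨Q * P, fun h => (h𝔭.mem_or_mem h).elim hQ hP, ?_⟩
  rwa [mul_assoc]

/-- `I ≤ 𝔭 ⇒ loc 𝔭 I ≤ 𝔭`. [folklore] -/
theorem loc_le (h : I ≤ 𝔭) : loc 𝔭 h𝔭 I ≤ 𝔭 := fun _ ⟨_, hP, hPf⟩ =>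
  (h𝔭.mem_or_mem (h hPf)).resolve_left hP

/-- `loc 𝔭 I` is proper when `I ≤ 𝔭`. [folklore] -/
theorem loc_ne_top (h : I ≤ 𝔭) : loc 𝔭 h𝔭 I ≠ ⊤ := fun htop =>
  h𝔭.ne_top (top_le_iff.mp (htop ▸ loc_le h𝔭 h))

/-- **Elements outside `𝔭` are non-zero-divisors modulo `loc 𝔭 I`.** [folklore] -/
theorem isNZDMod_loc (I : Ideal (MvPolynomial (Fin (n + 1)) ℂ)) {Q : MvPolynomial (Fin (n + 1)) ℂ}
    (hQ : Q ∉ 𝔭) : IsNZDMod (loc 𝔭 h𝔭 I) Q := by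
  rintro f ⟨P, hP, hPQf⟩
  refine ⟨P * Q, fun h => (h𝔭.mem_or_mem h).elim hP hQ, ?_⟩
  rwa [mul_assoc]

/-- If `P ∉ 𝔭` and `(P f)^e ∈ I` then `f^e ∈ loc 𝔭 I`. [folklore] -/
theorem pow_mem_loc {f P : MvPolynomial (Fin (n + 1)) ℂ} (hP : P ∉ 𝔭) {e : ℕ} (h : (P * f) ^ e ∈ I) :
    f ^ e ∈ loc 𝔭 h𝔭 I :=
  ⟨P ^ e, fun h' => hP (h𝔭.mem_of_pow_mem _ h'), by rwa [← mul_pow]⟩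

end Loc

/-- A non-zero-divisor modulo each member of a finite family of ideals is one modulo their
intersection. [folklore] -/
theorem isNZDMod_finsetInf {ι : Type*} (S : Finset ι) (J : ι → Ideal (MvPolynomial (Fin (n + 1)) ℂ))
    {Q : MvPolynomial (Fin (n + 1)) ℂ} (h : ∀ i ∈ S, IsNZDMod (J i) Q) : IsNZDMod (S.inf J) Q := by
  classical
  induction S using Finset.induction_on with
  | empty => intro f _; simp
  | insert a S ha ih =>
    intro f hf
    rw [Finset.inf_insert, Ideal.mem_inf] at hf ⊢
    exact ⟨h a (Finset.mem_insert_self a S) f hf.1,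
      ih (fun i hi => h i (Finset.mem_insert_of_mem hi)) f hf.2⟩

/-- A product of elements outside a prime is outside it. [folklore] -/
theorem prod_notMem_of_isPrime {ι : Type*} {𝔭 : Ideal (MvPolynomial (Fin (n + 1)) ℂ)} (h𝔭 : 𝔭.IsPrime)
    (S : Finset ι) (b : ι → MvPolynomial (Fin (n + 1)) ℂ) (hb : ∀ i ∈ S, b i ∉ 𝔭) : ∏ i ∈ S, b i ∉ 𝔭 := by
  classical
  induction S using Finset.induction_on with
  | empty => simpa using fun h => h𝔭.ne_top ((Ideal.eq_top_iff_one _).mpr h)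
  | insert a S ha ih =>
    rw [Finset.prod_insert ha]
    intro h
    rcases h𝔭.mem_or_mem h with h1 | h1
    · exact hb a (Finset.mem_insert_self a S) h1
    · exact ih (fun i hi => hb i (Finset.mem_insert_of_mem hi)) h1

/-! ### Thick additivity -/

/-- **Thick additivity.** Let `𝔭ᵢ` (`i ∈ S`) be pairwise incomparable primes containing `I` with
`𝔭ᵢ^{Mᵢ} ≤ loc 𝔭ᵢ I` (as when `𝔭ᵢ` is minimal over `I`). Then there is a shift `δ` with
`∑_{i ∈ S} H_{loc 𝔭ᵢ I}(t - δ) ≤ H_{⋂_{i ∈ S} loc 𝔭ᵢ I}(t)` for all `t ≥ δ` (`D₀, D₁ ≥ 1`).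
[cite: NesterenkoPhilippon2001, Ch. 11 §2.2 (ii)] -/
theorem exists_sum_hilbI_loc_le (hD₀ : 1 ≤ D₀) (hD₁ : 1 ≤ D₁) (I : Ideal (MvPolynomial (Fin (n + 1)) ℂ))
    {ι : Type*} (𝔭 : ι → Ideal (MvPolynomial (Fin (n + 1)) ℂ)) (h𝔭 : ∀ i, (𝔭 i).IsPrime)
    (hinc : ∀ i j, 𝔭 i ≤ 𝔭 j → i = j) (hI : ∀ i, I ≤ 𝔭 i)
    (hrad : ∀ i, ∃ M : ℕ, 𝔭 i ^ M ≤ loc (𝔭 i) (h𝔭 i) I) (S : Finset ι) :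
    ∃ δ : ℕ, ∀ t, δ ≤ t →
      ∑ i ∈ S, hilbI (n := n) D₀ D₁ ((loc (𝔭 i) (h𝔭 i) I).restrictScalars ℂ) (t - δ) ≤
        hilbI D₀ D₁ ((S.inf fun i => loc (𝔭 i) (h𝔭 i) I).restrictScalars ℂ) t := by
  classical
  induction S using Finset.induction_on with
  | empty => exact ⟨0, fun t _ => by simp⟩
  | insert i₀ S hi₀ ih =>
    obtain ⟨δ, hδ⟩ := ih
    -- an element of `⋂_{S} loc 𝔭ᵢ I` outside `𝔭 i₀`: a product of powers of elements `xᵢ ∈ 𝔭ᵢ \ 𝔭 i₀`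
    have hx : ∀ i ∈ S, ∃ b : MvPolynomial (Fin (n + 1)) ℂ, b ∈ loc (𝔭 i) (h𝔭 i) I ∧ b ∉ 𝔭 i₀ := by
      intro i hi
      have hne : i ≠ i₀ := fun h => hi₀ (h ▸ hi)
      have hnot : ¬ (𝔭 i ≤ 𝔭 i₀) := fun hle => hne (hinc i i₀ hle)
      obtain ⟨x, hxi, hxi₀⟩ := Set.not_subset.mp hnot
      obtain ⟨M, hM⟩ := hrad i
      exact ⟨x ^ M, hM (Ideal.pow_mem_pow hxi M), fun h => hxi₀ ((h𝔭 i₀).mem_of_pow_mem _ h)⟩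
    choose! b hb using hx
    set a : MvPolynomial (Fin (n + 1)) ℂ := ∏ i ∈ S, b i with ha
    have haN : a ∈ S.inf fun i => loc (𝔭 i) (h𝔭 i) I := by
      refine Submodule.mem_finsetInf.mpr fun i hi => ?_
      rw [ha, ← Finset.mul_prod_erase S b hi]
      exact Ideal.mul_mem_right _ _ (hb i hi).1
    have ha𝔭 : a ∉ 𝔭 i₀ := prod_notMem_of_isPrime (h𝔭 i₀) S b fun i hi => (hb i hi).2
    set δ' := a.totalDegree with hδ'
    have haB : a ∈ Box (n := n) D₀ D₁ δ' := mem_Box_totalDegree hD₀ hD₁ a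
    refine ⟨δ + δ', fun t ht => ?_⟩
    rw [Finset.sum_insert hi₀, Finset.inf_insert]
    have key := hilbI_add_le_hilbI_inf_of_nzd (D₀ := D₀) (D₁ := D₁)
      (N := (S.inf fun i => loc (𝔭 i) (h𝔭 i) I).restrictScalars ℂ) (J := loc (𝔭 i₀) (h𝔭 i₀) I)
      (loc_ne_top (h𝔭 i₀) (hI i₀)) haB haN (fun x y hy => Ideal.mul_mem_left _ x hy)
      (isNZDMod_loc (h𝔭 i₀) I ha𝔭) (t := t) (by omega)
    have hrs : (S.inf fun i => loc (𝔭 i) (h𝔭 i) I).restrictScalars ℂ ⊓ (loc (𝔭 i₀) (h𝔭 i₀) I).restrictScalars ℂ =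
        (loc (𝔭 i₀) (h𝔭 i₀) I ⊓ S.inf fun i => loc (𝔭 i) (h𝔭 i) I).restrictScalars ℂ := by
      rw [inf_comm, Submodule.restrictScalars_inf]
    rw [hrs] at key
    have h1 := hδ t (by omega)
    have h2 : ∑ i ∈ S, hilbI (n := n) D₀ D₁ ((loc (𝔭 i) (h𝔭 i) I).restrictScalars ℂ) (t - (δ + δ')) ≤
        ∑ i ∈ S, hilbI (n := n) D₀ D₁ ((loc (𝔭 i) (h𝔭 i) I).restrictScalars ℂ) (t - δ) :=
      Finset.sum_le_sum fun i _ => hilbI_mono _ (by omega)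
    have h3 : hilbI (n := n) D₀ D₁ ((loc (𝔭 i₀) (h𝔭 i₀) I).restrictScalars ℂ) (t - (δ + δ')) ≤
        hilbI D₀ D₁ ((loc (𝔭 i₀) (h𝔭 i₀) I).restrictScalars ℂ) (t - δ') := hilbI_mono _ (by omega)
    omega

end GaGm

end Literature.NumberTheory.Transcendental
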